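import Summits.HodgeConjecture.CorCM.IrreducibleOddWeightsHelly
import Summits.HodgeConjecture.CorCM.IrreducibleOddWeightsCoveringFamily
import HarnessLib

/-!
# Minimal degenerate families: every member of a minimal exceptional product of `m` CM abelian varieties has
# dimension at least `m − 1`

COR-CM (cell `pub-hodgecm2`, binder seat `b16` gen 59, count-neutral claim INDEX BOUND, file F6 — abstract `G`-set level
and CM fields; theorems only, no definition, no named fact, no `sorry`).  NEW as stated, hence under `Summits/`.  HONEST
FRAMING: unconditional finite-dimensional linear algebra over `ℚ` about the rank of families of CM types (= `dim` of
the Mumford–Tate group of a product of CM abelian varieties); `HC_CM` is neither used nor asserted.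

A family of CM types `(Φ_i)_{i ∈ T₀}` is MINIMAL DEGENERATE if it is degenerate (`dim Hg(∏_{T₀} A_i) < Σ dim A_i`) while
every non-empty proper sub-family is nondegenerate — the minimal exceptional products, on which an exceptional Hodge
class first appears.  The Helly-type bounds of this claim (gen 58 `…Helly`, F3 `…IndexHelly`, F5 `…DegreeHelly`) bound
`|T₀|` uniformly by `q + 1`.  THIS FILE bounds it by EACH MEMBER:

* **`card_le_finrank_antiSpan_succ_of_minimal`** (covering irreducibles given) and
  **`card_le_finrank_antiSpan_succ_of_minimal'`** (none listed, F2): `|T₀| ≤ dim U(Φ_i) + 1 = rank(Φ_i)` for EVERY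
  `i ∈ T₀`; hence **`card_le_half_card_succ_of_minimal`**: `|T₀| ≤ |E_i|/2 + 1` for every member.
  PROOF.  Members of `T₀` are nondegenerate (singletons are proper), so by the gen-57 criterion some irreducible `V_k`
  carries DEPENDENT slot evaluation spaces `Ev_j(π_k)`, `j ∈ T₀`, every proper sub-collection being independent; then
  every `Ev_j(π_k)` is non-zero (else drop it), so (i) `T₀ ∖ {i}` gives `|T₀| − 1` independent non-zero subspaces of
  `V_k`: `|T₀| − 1 ≤ d_k`, and (ii) `Ev_i(π_k) ≠ 0` makes the irreducible `V_k` a quotient of `U(Φ_i)`: `d_k ≤ dim U(Φ_i)`.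
* CM fields — **`card_le_finrank_div_two_succ_of_minimal`**: in a minimal degenerate family of CM abelian varieties
  `A_i` (`i ∈ T₀`, CM by `K_i`), `|T₀| ≤ [K_i:ℚ]/2 + 1 = dim A_i + 1` for EVERY member: an exceptional Hodge class that
  needs `m` factors needs every factor to have dimension `≥ m − 1`; **`card_le_two_of_minimal_of_finrank_le_two`**: a
  minimal degenerate family containing a CM ELLIPTIC CURVE has at most two members (a CM elliptic curve `E` spoils
  `Hg(E × ∏ A_i) = Hg(E) × ∏ Hg(A_i)` only through a single partner `A_i` with `Hg(E × A_i) ≠ Hg(E) × Hg(A_i)`).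

## References

* [Mai1989] L. Mai, *Lower bounds for the ranks of CM types*, J. Number Theory 32 (1989), §2 Prop. 1 (proof).
* [Serre1977] J.-P. Serre, *Linear Representations of Finite Groups*, GTM 42 (1977), §1.4 Thm. 2, §2.2 Prop. 4.
* [Gordon1999HodgeAVSurvey] B. B. Gordon, *A survey of the Hodge conjecture for abelian varieties*, §3, 7.5–7.7.
* [Shimura1998] G. Shimura, *Abelian Varieties with Complex Multiplication and Modular Functions*, §32.10 Prop.
-/

set_option autoImplicit false

noncomputable section

open scoped BigOperators

open CategoryTheory CategoryTheory.Limits NumberField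

universe u u' v w

namespace Summit.HodgeConjecture.CorCM

namespace IrrOdd

open Literature.NumberTheory.ComplexMultiplication

variable {G : Type w} [Group G]

/-- The evaluation space `Ev[G, π, w] = {T w : T equivariant}` (local notation, no definition). -/
local notation3 (prettyPrint := false) "Ev[" G' ", " π ", " w "]" =>
  Submodule.span ℚ {v | ∃ T : (_ → ℚ) →ₗ[ℚ] _,
    (∀ (g : G') (f : _ → ℚ), T (fun x => f (g⁻¹ • x)) = π g (T f)) ∧ T w = v}

variable {I : Type u} {E : I → Type v} [∀ i, MulAction G (E i)] [Fintype I] [∀ i, Fintype (E i)]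
  {K : Type u'} [Fintype K] {V : K → Type*} [∀ k, AddCommGroup (V k)] [∀ k, Module ℚ (V k)]
  [∀ k, FiniteDimensional ℚ (V k)]

/-! ### §1 Minimal degenerate families, covering irreducibles given -/

omit [Fintype I] in
/-- **EVERY MEMBER OF A MINIMAL DEGENERATE FAMILY HAS `rank(Φ_i) ≥ |T₀|`.**  Pairwise non-isomorphic irreducibles
`(π_k, V_k)` covering the members; `T₀` a degenerate sub-family all of whose non-empty proper sub-families are
nondegenerate.  THEN `|T₀| ≤ dim U(Φ_i) + 1` for every `i ∈ T₀`: some `V_k` carries dependent slot evaluation spaces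
`Ev_j(π_k)` (`j ∈ T₀`), all non-zero with every proper sub-collection independent, so `|T₀| − 1 ≤ d_k`, and `V_k`,
receiving `u_1(Φ_i)` non-trivially, is a quotient of `U(Φ_i)`: `d_k ≤ dim U(Φ_i)`.
[cite: Mai1989, §2 Prop. 1 (proof)] [cite: Serre1977, §2.2 Prop. 4] [cite: Gordon1999HodgeAVSurvey, 7.5–7.7] -/
theorem card_le_finrank_antiSpan_succ_of_minimal [∀ i, Nonempty (E i)] [Nonempty I] {ρ : G}
    {Φ : ∀ i, Set (E i)} (h : ∀ i, IsCMTypeWith ρ (Φ i)) (π : ∀ k, Representation ℚ G (V k))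
    (hirr : ∀ k, (π k).IsIrreducible) (hne : ∀ k l, k ≠ l → ∀ S : (π k).IntertwiningMap (π l), S = 0)
    (hcov : ∀ (i : I) (P : Submodule ℚ (E i → ℚ)), P ≤ antiSpan G (Φ i) → P ≠ ⊥ →
      (∀ (g : G) (a : E i → ℚ), a ∈ P → (fun s => a (g • s)) ∈ P) →
      ∃ k, ∃ T : (E i → ℚ) →ₗ[ℚ] V k,
        (∀ (g : G) (a : E i → ℚ), T (fun s => a (g⁻¹ • s)) = π k g (T a)) ∧ ∃ a ∈ P, T a ≠ 0)
    (T₀ : Finset I)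
    (hdeg : typeRank G (sigmaType fun j : (T₀ : Set I) => Φ j) ≠ Fintype.card (Σ j : (T₀ : Set I), E j) / 2 + 1)
    (hmin : ∀ T : Finset I, T ⊂ T₀ → T.Nonempty →
      typeRank G (sigmaType fun j : (T : Set I) => Φ j) = Fintype.card (Σ j : (T : Set I), E j) / 2 + 1)
    {i : I} (hi : i ∈ T₀) : T₀.card ≤ Module.finrank ℚ (antiSpan G (Φ i)) + 1 := by
  classical
  by_cases hsmall : T₀.card ≤ 1
  · exact hsmall.trans (Nat.le_add_left 1 _)
  have hT₀ne : T₀.Nonempty := Finset.card_pos.1 (by omega)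
  -- F9 for every non-empty sub-family
  have hFT : ∀ T : Finset I, T.Nonempty →
      (typeRank G (sigmaType fun j : (T : Set I) => Φ j) = Fintype.card (Σ j : (T : Set I), E j) / 2 + 1 ↔
        (∀ j : (T : Set I), typeRank G (Φ j) = Fintype.card (E j) / 2 + 1) ∧
          ∀ k, Module.finrank ℚ (⨆ j : (T : Set I), Ev[G, π k, antiVec (Φ j) (1 : G)] : Submodule ℚ (V k)) =
            ∑ j : (T : Set I), Module.finrank ℚ Ev[G, π k, antiVec (Φ j) (1 : G)]) := by
    intro T hT
    obtain ⟨i₁, hi₁⟩ := hT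
    haveI : Nonempty (Σ j : (T : Set I), E j) := ⟨⟨⟨i₁, hi₁⟩, Classical.arbitrary _⟩⟩
    exact typeRank_sigmaType_eq_iff_forall_and (E := fun j : (T : Set I) => E j) (fun j => h j) π hirr hne
      fun j => hcov j
  -- the slot evaluation spaces
  set S : ∀ k, I → Submodule ℚ (V k) := fun k i => Ev[G, π k, antiVec (Φ i) (1 : G)] with hS
  have hδpos : ∀ k, 0 < Module.finrank ℚ ((π k).IntertwiningMap (π k)) := fun k =>
    finrank_intertwiningMap_pos (π k) (hirr k)
  have hdvd : ∀ k i, Module.finrank ℚ ((π k).IntertwiningMap (π k)) ∣ Module.finrank ℚ (S k i) := fun k i =>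
    (finrank_antiSpan_eq_sum (Φ i) π hirr hne (hcov i)).1 k
  have hsupT : ∀ (k) (T : Finset I), (⨆ j : (T : Set I), S k j : Submodule ℚ (V k)) = T.sup (S k) := fun k T =>
    (finsetSup_eq_iSup_subtype (S k) T).symm
  have hsumT : ∀ (k) (T : Finset I), ∑ j : (T : Set I), Module.finrank ℚ (S k j) =
      ∑ i ∈ T, Module.finrank ℚ (S k i) := fun k T => Finset.sum_coe_sort T fun i => Module.finrank ℚ (S k i)
  -- proper non-empty sub-families of `T₀` are independent in every `V_k`
  have hind : ∀ T : Finset I, T ⊂ T₀ → T.Nonempty → ∀ k,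
      Module.finrank ℚ (T.sup (S k) : Submodule ℚ (V k)) = ∑ i ∈ T, Module.finrank ℚ (S k i) := by
    intro T hT hTne k
    have h1 := ((hFT T hTne).1 (hmin T hT hTne)).2 k
    change Module.finrank ℚ (⨆ j : (T : Set I), S k j : Submodule ℚ (V k)) = ∑ j : (T : Set I), Module.finrank ℚ (S k j)
      at h1
    rwa [hsupT, hsumT] at h1
  -- members of `T₀` are nondegenerate (singletons are proper sub-families)
  have hmem : ∀ j : (T₀ : Set I), typeRank G (Φ j) = Fintype.card (E j) / 2 + 1 := by
    intro j
    have hsub : ({(j : I)} : Finset I) ⊂ T₀ := by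
      refine Finset.ssubset_iff_subset_ne.2 ⟨Finset.singleton_subset_iff.2 j.2, fun heq => hsmall ?_⟩
      rw [← heq, Finset.card_singleton]
    have h1 := (hFT {(j : I)} (Finset.singleton_nonempty _)).1 (hmin _ hsub (Finset.singleton_nonempty _))
    exact h1.1 ⟨j.1, Finset.mem_singleton_self _⟩
  -- hence some `V_k` carries dependent slot evaluation spaces over `T₀`
  obtain ⟨k, hk⟩ : ∃ k, Module.finrank ℚ (T₀.sup (S k) : Submodule ℚ (V k)) ≠ ∑ i ∈ T₀, Module.finrank ℚ (S k i) := by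
    by_contra hall
    push Not at hall
    refine hdeg ((hFT T₀ hT₀ne).2 ⟨hmem, fun k => ?_⟩)
    change Module.finrank ℚ (⨆ j : (T₀ : Set I), S k j : Submodule ℚ (V k)) = ∑ j : (T₀ : Set I), Module.finrank ℚ (S k j)
    rw [hsupT, hsumT]
    exact hall k
  -- every member of `T₀` has a non-zero evaluation space in `V_k`
  have hne0 : ∀ j ∈ T₀, S k j ≠ ⊥ := by
    intro j hj h0
    apply hk
    have hne' : (T₀.erase j).Nonempty := by
      rw [← Finset.card_pos, Finset.card_erase_of_mem hj]
      omega
    have h' := hind _ (Finset.erase_ssubset hj) hne' k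
    rw [← Finset.insert_erase hj, Finset.sup_insert, Finset.sum_insert (Finset.notMem_erase j T₀), h0, bot_sup_eq,
      finrank_bot, zero_add, h']
  -- (i) `|T₀| − 1 ≤ d_k`: `T₀ ∖ {i}` gives independent non-zero subspaces of `V_k`
  have hcardk : T₀.card - 1 ≤ Module.finrank ℚ (V k) := by
    have hne' : (T₀.erase i).Nonempty := by
      rw [← Finset.card_pos, Finset.card_erase_of_mem hi]
      omega
    have h' := hind _ (Finset.erase_ssubset hi) hne' k
    have hge : (T₀.erase i).card ≤ ∑ j ∈ T₀.erase i, Module.finrank ℚ (S k j) := by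
      rw [Finset.card_eq_sum_ones]
      refine Finset.sum_le_sum fun j hj => ?_
      exact Nat.pos_of_ne_zero fun h0 => hne0 j (Finset.mem_of_mem_erase hj) (Submodule.finrank_eq_zero.1 h0)
    have hle : ∑ j ∈ T₀.erase i, Module.finrank ℚ (S k j) ≤ Module.finrank ℚ (V k) := h' ▸ Submodule.finrank_le _
    rw [Finset.card_erase_of_mem hi] at hge
    exact hge.trans hle
  -- (ii) `d_k ≤ dim U(Φ_i)`: `V_k` is a quotient of `U(Φ_i)`
  have hdk : Module.finrank ℚ (V k) ≤ Module.finrank ℚ (antiSpan G (Φ i)) := by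
    obtain ⟨T, hT, hT0⟩ : ∃ T : (E i → ℚ) →ₗ[ℚ] V k,
        (∀ (g : G) (f : E i → ℚ), T (fun x => f (g⁻¹ • x)) = π k g (T f)) ∧ T (antiVec (Φ i) (1 : G)) ≠ 0 := by
      by_contra hall
      push Not at hall
      refine hne0 i hi (Submodule.span_eq_bot.2 ?_)
      rintro v ⟨T, hT, rfl⟩
      exact hall T hT
    haveI := hirr k
    let W : Subrepresentation (π k) := ⟨(antiSpan G (Φ i)).map T, fun g w hw => by
      obtain ⟨b, hb, rfl⟩ := hw
      exact ⟨fun s => b (g⁻¹ • s), comp_smul_mem_antiSpan hb g⁻¹, hT g b⟩⟩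
    rcases (hirr k).eq_bot_or_eq_top W with hW | hW
    · exfalso
      apply hT0
      have hmemW : T (antiVec (Φ i) (1 : G)) ∈ W.toSubmodule :=
        ⟨antiVec (Φ i) (1 : G), Submodule.subset_span ⟨1, rfl⟩, rfl⟩
      rw [hW] at hmemW
      exact (Submodule.mem_bot ℚ).1 hmemW
    · have htop : (antiSpan G (Φ i)).map T = ⊤ := congrArg Subrepresentation.toSubmodule hW
      calc Module.finrank ℚ (V k) = Module.finrank ℚ (⊤ : Submodule ℚ (V k)) := (finrank_top ℚ (V k)).symm
        _ = Module.finrank ℚ ((antiSpan G (Φ i)).map T) := by rw [htop]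
        _ ≤ Module.finrank ℚ (antiSpan G (Φ i)) := Submodule.finrank_map_le T _
  omega

/-! ### §2 No representation listed -/

/-- **`|T₀| ≤ rank(Φ_i) = dim U(Φ_i) + 1` FOR EVERY MEMBER OF A MINIMAL DEGENERATE FAMILY — no representation listed**
(a covering list of pairwise disjoint irreducibles exists, F2 `…CoveringFamily`).  `G` arbitrary on finite slots.
[cite: Mai1989, §2 Prop. 1 (proof)] [cite: Serre1977, §1.4 Thm. 2 and §2.2 Prop. 4] [cite: Gordon1999HodgeAVSurvey, 7.5–7.7] -/
theorem card_le_finrank_antiSpan_succ_of_minimal' [∀ i, Nonempty (E i)] [Nonempty I] {ρ : G}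
    {Φ : ∀ i, Set (E i)} (h : ∀ i, IsCMTypeWith ρ (Φ i)) (T₀ : Finset I)
    (hdeg : typeRank G (sigmaType fun j : (T₀ : Set I) => Φ j) ≠ Fintype.card (Σ j : (T₀ : Set I), E j) / 2 + 1)
    (hmin : ∀ T : Finset I, T ⊂ T₀ → T.Nonempty →
      typeRank G (sigmaType fun j : (T : Set I) => Φ j) = Fintype.card (Σ j : (T : Set I), E j) / 2 + 1)
    {i : I} (hi : i ∈ T₀) : T₀.card ≤ Module.finrank ℚ (antiSpan G (Φ i)) + 1 := by
  classical
  obtain ⟨n, S, π, K, -, hirr, hne, hcov⟩ := exists_covering_irreducibles_slots (G := G) (E := E)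
  refine card_le_finrank_antiSpan_succ_of_minimal (K := K) (V := fun k : K => S k.1) h (fun k => π k.1)
    (fun k => hirr k.1) (fun k l hkl T => hne k.1 k.2 l.1 l.2 (fun h' => hkl (Subtype.ext h')) T)
    (fun i P _ hP0 hPst => ?_) T₀ hdeg hmin hi
  obtain ⟨k, hk, T, hT, a, ha, ha0⟩ := hcov i P hP0 hPst
  exact ⟨⟨k, hk⟩, T, hT, a, ha, ha0⟩

/-- **`|T₀| ≤ |E_i|/2 + 1` FOR EVERY MEMBER OF A MINIMAL DEGENERATE FAMILY** (`dim U(Φ_i) ≤ |E_i|/2`, Shimura): a slot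
of size `2n` never takes part in a minimal degenerate family of more than `n + 1` members. [cite: Shimura1998, §32.10 Prop.]
[cite: Mai1989, §2 Prop. 1 (proof)] [cite: Gordon1999HodgeAVSurvey, 7.5–7.7] -/
theorem card_le_half_card_succ_of_minimal [∀ i, Nonempty (E i)] [Nonempty I] {ρ : G}
    {Φ : ∀ i, Set (E i)} (h : ∀ i, IsCMTypeWith ρ (Φ i)) (T₀ : Finset I)
    (hdeg : typeRank G (sigmaType fun j : (T₀ : Set I) => Φ j) ≠ Fintype.card (Σ j : (T₀ : Set I), E j) / 2 + 1)
    (hmin : ∀ T : Finset I, T ⊂ T₀ → T.Nonempty →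
      typeRank G (sigmaType fun j : (T : Set I) => Φ j) = Fintype.card (Σ j : (T : Set I), E j) / 2 + 1)
    {i : I} (hi : i ∈ T₀) : T₀.card ≤ Fintype.card (E i) / 2 + 1 := by
  have h1 := card_le_finrank_antiSpan_succ_of_minimal' h T₀ hdeg hmin hi
  have h2 := (h i).typeRank_eq_finrank_antiSpan_add_one (G := G)
  have h3 := (h i).typeRank_le (G := G)
  omega

end IrrOdd

/-! ### §3 CM fields: every member of a minimal exceptional product of `m` factors has dimension `≥ m − 1` -/

open Literature.NumberTheory.ComplexMultiplication
open Literature.AlgebraicGeometry.Motives (CMType)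
open Literature.AlgebraicGeometry.Pohlmann1968

variable {I : Type} [Fintype I] {K : I → Type} [∀ i, Field (K i)] [∀ i, NumberField (K i)] [∀ i, IsCMField (K i)]

/-- **MINIMAL DEGENERATE FAMILIES OF CM ABELIAN VARIETIES: `|T₀| ≤ dim A_i + 1` FOR EVERY MEMBER.**  CM fields `K_i`, CM
types `Φ_i`; `T₀` a sub-family which is degenerate (`dim Hg(∏_{T₀} A_i) < Σ_{T₀} dim A_i`) while every non-empty proper
sub-family is nondegenerate.  THEN `2(|T₀| − 1) ≤ [K_i : ℚ]` for every `i ∈ T₀`: an exceptional Hodge class which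
needs `m` CM factors needs every one of them to have dimension at least `m − 1`.  No Galois group, representation or
character is listed. [cite: Shimura1998, §32.10 Prop.] [cite: Mai1989, §2 Prop. 1 (proof)] [cite: Gordon1999HodgeAVSurvey, 7.5–7.7] -/
theorem card_le_finrank_div_two_succ_of_minimal [Nonempty I] (Φ : ∀ i, CMType (K i)) (T₀ : Finset I)
    (hdeg : ¬ CMAlgebra.IsNondegenerateFamily (K := fun j : (T₀ : Set I) => K j) fun j => Φ j)
    (hmin : ∀ T : Finset I, T ⊂ T₀ → T.Nonempty →
      CMAlgebra.IsNondegenerateFamily (K := fun j : (T : Set I) => K j) fun j => Φ j)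
    {i : I} (hi : i ∈ T₀) : T₀.card ≤ Module.finrank ℚ (K i) / 2 + 1 := by
  classical
  haveI : ∀ i, Nonempty (K i →+* ℂ) := fun i => inferInstance
  have hcardT : ∀ T : Finset I, Fintype.card (Σ j : (T : Set I), (K j →+* ℂ)) =
      ∑ j : (T : Set I), Module.finrank ℚ (K j) := by
    intro T
    rw [Fintype.card_sigma]
    exact Finset.sum_congr rfl fun j _ => Embeddings.card (K j) ℂ
  have hiff : ∀ T : Finset I,
      (CMAlgebra.IsNondegenerateFamily (K := fun j : (T : Set I) => K j) fun j => Φ j) ↔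
        typeRank (ℂ ≃+* ℂ) (sigmaType fun j : (T : Set I) => (Φ j).1) =
          Fintype.card (Σ j : (T : Set I), (K j →+* ℂ)) / 2 + 1 := by
    intro T
    rw [CMAlgebra.isNondegenerateFamily_iff, ← hcardT T]
    rfl
  have h1 := IrrOdd.card_le_half_card_succ_of_minimal (E := fun i => K i →+* ℂ) (fun i => isCMTypeWith_conj (Φ i)) T₀
    (fun h => hdeg ((hiff T₀).2 h)) (fun T hT hTne => (hiff T).1 (hmin T hT hTne)) hi
  rwa [Embeddings.card (K i) ℂ] at h1

/-- **A MINIMAL DEGENERATE FAMILY CONTAINING A CM ELLIPTIC CURVE HAS AT MOST TWO MEMBERS**: if `[K_i:ℚ] ≤ 2` for some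
member `i ∈ T₀`, then `|T₀| ≤ 2` — a CM elliptic curve `E` can spoil `Hg(E × ∏_j A_j) = Hg(E) × ∏_j Hg(A_j)` (for an
otherwise nondegenerate family) only through ONE partner `A_j` with `Hg(E × A_j) ≠ Hg(E) × Hg(A_j)`.
[cite: Gordon1999HodgeAVSurvey, §3 and 7.5–7.7] [cite: Shimura1998, §32.10 Prop.] -/
theorem card_le_two_of_minimal_of_finrank_le_two [Nonempty I] (Φ : ∀ i, CMType (K i)) (T₀ : Finset I)
    (hdeg : ¬ CMAlgebra.IsNondegenerateFamily (K := fun j : (T₀ : Set I) => K j) fun j => Φ j)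
    (hmin : ∀ T : Finset I, T ⊂ T₀ → T.Nonempty →
      CMAlgebra.IsNondegenerateFamily (K := fun j : (T : Set I) => K j) fun j => Φ j)
    {i : I} (hi : i ∈ T₀) (hKi : Module.finrank ℚ (K i) ≤ 2) : T₀.card ≤ 2 := by
  have h1 := card_le_finrank_div_two_succ_of_minimal Φ T₀ hdeg hmin hi
  omega

omit [Fintype I] [∀ i, IsCMField (K i)] in
/-- **Every degenerate family CONTAINS a minimal degenerate sub-family** (take a degenerate sub-family of least
cardinality), to which the member bounds apply. [folklore] -/
theorem exists_minimal_of_not_isNondegenerateFamily [Nonempty I] (Φ : ∀ i, CMType (K i)) (T₁ : Finset I)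
    (hdeg : ¬ CMAlgebra.IsNondegenerateFamily (K := fun j : (T₁ : Set I) => K j) fun j => Φ j) :
    ∃ T₀ : Finset I, T₀ ⊆ T₁ ∧
      ¬ CMAlgebra.IsNondegenerateFamily (K := fun j : (T₀ : Set I) => K j) (fun j => Φ j) ∧
      ∀ T : Finset I, T ⊂ T₀ → T.Nonempty →
        CMAlgebra.IsNondegenerateFamily (K := fun j : (T : Set I) => K j) fun j => Φ j := by
  classical
  have hex : ∃ m, ∃ T : Finset I, T ⊆ T₁ ∧ T.card = m ∧
      ¬ CMAlgebra.IsNondegenerateFamily (K := fun j : (T : Set I) => K j) fun j => Φ j :=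
    ⟨_, T₁, Finset.Subset.refl _, rfl, hdeg⟩
  obtain ⟨T₀, hT₀T₁, hT₀card, hT₀deg⟩ := Nat.find_spec hex
  refine ⟨T₀, hT₀T₁, hT₀deg, fun T hT _ => ?_⟩
  by_contra hTdeg
  have hlt : T.card < Nat.find hex := by
    rw [← hT₀card]
    exact Finset.card_lt_card hT
  exact Nat.find_min hex hlt ⟨T, hT.1.trans hT₀T₁, rfl, hTdeg⟩

end Summit.HodgeConjecture.CorCM

end
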